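import Summits.QuantumAdvantage.QuantumAdvantage.Theorems.CubicForrelationSignedExactCubicForrelationNotPrBPPStubCoreReductionZero

/-!
# Crux `CubicForrelation.SignedExactCubicForrelationNotPrBPP` (stmt-QuantumAdvantage-13932), line `dual-pingpong-frame`
# (classify-then-count cut), stub `stub_coreReduction'` — THE CUBE-ORBIT DATUM OF A CUBE-TYPE ORBIT DATUM

Support file (`--supports stmt-QuantumAdvantage-13932`) for the reshaped glue `stub_coreReduction'`
((H1) classification of affine-free biquadratic permutations ∧ (H2) cube statistics at `(0,0)` ∧ (H3) rich
rectangular data ∧ (H4) cube block sums ⇒ the live line's core statement). Three bricks, all in the tree vocabulary of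
the registered stubs (bit vectors `Fin n → Bool`, `bxor`, the inner product bit, `ZMod 2` readings `[·]`):

* `affine_toMatrix`: an affine map `Θ` of bit vectors (`Θ (x ⊕ y) = Θ x ⊕ Θ y ⊕ Θ 0`) has the matrix form
  `[Θ y] = M [y] + c` over `ZMod 2` demanded of the orbit data of the core statement (columns `Θ eⱼ ⊕ Θ 0`, constant
  `Θ 0`; an additive functional is the sum of its values on the unit vectors, `QuadSampler.additive_eq_sum`);
* `perm_quadratic`: for an exact cubic pair `(a, b)` with orbit datum `[b (e (y' ‖ y''))] = ∑ᵢ [y'ᵢ][perm(y'')ᵢ] + [h y'']`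
  (`e` affine) the permutation `perm` AND its inverse have quadratic coordinates — Steps 1–2 of the landed
  `coreReduction_zero`: transport `b₀ = b ∘ e`, `a₀ = a ∘ L⁻ᵀ ⊕ (L⁻ᵀ·)·c` (`Covariance.forrelation_transport`), the dual
  shape of `a₀` (`stub_dualShape`) and `Covariance.isDegLeFun_two_perm/_symm`;
* `cubeOrbitDatum`: if moreover `perm` is CUBE-TYPE — `E₁ ∘ perm = cube ∘ E₂` blockwise for affine bijections `E₁, E₂`
  onto the block coordinates `(𝔽₂³)^k`, the output of (H1) — then the SAME `b` carries a CUBE-ORBIT DATUM: with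
  `Λᵢ := flatten ∘ Eᵢ` (blocks flattened by `finProdFinEquiv`), `N` the linear part of `Λ₁⁻¹`, `N⁻ᵀ` its inverse adjoint
  and `e' := e ∘ (N⁻ᵀ ‖ Λ₂⁻¹)` (an affine bijection; matrix form by `affine_toMatrix`) one has, over `ZMod 2`,
  `[b (e' (y' ‖ y''))] = ∑ᵢ [y'ᵢ][cube^k(y'')ᵢ] + [h (Λ₂⁻¹ y'')] + ∑ᵢ [y'ᵢ][ℓᵢ]` with `ℓ := N⁻¹(Λ₁⁻¹ 0)` — literally the
  orbit hypothesis of (H4) `stub_cubeBlockSums` (Steps 5–8 of `coreReduction_zero`, whose Boolean identity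
  `b (e' (y' ‖ y'')) = y'·cube^k(y'') ⊕ h(Λ₂⁻¹ y'') ⊕ y'·ℓ` is read back in `ZMod 2`, converse of `Covariance.template_bool`).

References: C. Carlet, *Boolean Functions for Cryptography and Coding Theory*, CUP 2021, §2.2.2, Prop. 54, Prop. 77
[Carlet2020]; S. Aaronson, A. Ambainis, Forrelation, SIAM J. Comput. 47 (2018), §1.1.1 [AaronsonAmbainis2018]. -/

noncomputable section

set_option linter.dupNamespace false -- D-0017: single-problem summit ⇒ `QuantumAdvantage.QuantumAdvantage` by design

namespace Summit.QuantumAdvantage.QuantumAdvantage.Theorems.SignedExactCubicForrelationNotPrBPP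

open Finset
open Literature.Computability.Complexity Literature.Computability.QuantumComplexity
open Literature.Computability.QuantumComplexity.BuzetChailloux (bxor zeroVec bxor_self bxor_comm bxor_zeroVec zeroVec_bxor)
open Literature.Computability.Complexity.BLR (toZ toZ_xor toZ_and toZ_injective)
open PolarGeometry (toZ_bdot bdot_comm bdot_bxor_left bdot_bxor_right bxor_append exists_append)
open NoTrap (bdot_unit bdot_zeroVec)
open Summit.QuantumAdvantage.QuantumAdvantage.Theorems.SignedCubicForrelationNotPrBPP (knf_isDegLeFun_comp
  knf_isDegLeFun_xor')
open Summit.QuantumAdvantage.QuantumAdvantage.Theorems.CubicForrelation.NearExactIsExact (ur_bxor_cancel_right)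
open Covariance

namespace Covariance

variable {n m : ℕ}

/-! ### Matrix form of an affine map -/

/-- **Matrix form of an affine map.** If `Θ (x ⊕ y) = Θ x ⊕ Θ y ⊕ Θ 0` then `[Θ y] = M [y] + c` over `ZMod 2` with
`M i j = [Θ eⱼ ⊕ Θ 0]ᵢ` and `c = [Θ 0]`: the linear part `y ↦ Θ y ⊕ Θ 0` is additive, and an additive functional is the
sum of its values on the unit vectors. [cite: Carlet2020, §2.2.2] -/
theorem affine_toMatrix {Θ : (Fin n → Bool) → (Fin n → Bool)}
    (hΘ : ∀ x y, Θ (bxor x y) = bxor (bxor (Θ x) (Θ y)) (Θ zeroVec)) :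
    ∃ M : Matrix (Fin n) (Fin n) (ZMod 2), ∃ c : Fin n → ZMod 2,
      ∀ y i, (if Θ y i then (1 : ZMod 2) else 0) = (M.mulVec (fun j => if y j then (1 : ZMod 2) else 0) + c) i := by
  have hP : ∀ x y, bxor (Θ (bxor x y)) (Θ zeroVec) = bxor (bxor (Θ x) (Θ zeroVec)) (bxor (Θ y) (Θ zeroVec)) :=
    linPart_additive hΘ
  refine ⟨Matrix.of fun i j => toZ (bxor (Θ (fun c => decide (c = j))) (Θ zeroVec) i), fun i => toZ (Θ zeroVec i),
    fun y i => ?_⟩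
  have hadd := QuadSampler.additive_eq_sum (fun y => toZ (bxor (Θ y) (Θ zeroVec) i))
    (by show toZ (bxor (Θ zeroVec) (Θ zeroVec) i) = 0
        rw [bxor_self]; rfl)
    (fun x x' => by
      show toZ (bxor (Θ (bxor x x')) (Θ zeroVec) i) = _
      rw [hP]
      exact toZ_xor _ _) y
  have e1 : toZ (Θ y i) = toZ (bxor (Θ y) (Θ zeroVec) i) + toZ (Θ zeroVec i) := by
    show toZ (Θ y i) = toZ (Θ y i ^^ Θ zeroVec i) + toZ (Θ zeroVec i)
    rw [toZ_xor, add_assoc, CharTwo.add_self_eq_zero, add_zero]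
  show toZ (Θ y i) = _
  rw [e1, hadd, Pi.add_apply]
  simp only [Matrix.mulVec, dotProduct, Matrix.of_apply]
  congr 1
  refine sum_congr rfl fun j _ => ?_
  rw [mul_comm]
  rfl

/-! ### The template permutation and its inverse are quadratic -/

/-- **Quadratic coordinates of the template permutation and of its inverse.** For an exact cubic pair `(a, b)`
(`Φ(a,b) = ±1`) on a completed Maiorana–McFarland orbit, `[b (e (y' ‖ y''))] = ∑ᵢ [y'ᵢ][perm(y'')ᵢ] + [h y'']` with `e`
affine, both `perm` and `perm⁻¹` have quadratic coordinates: `b₀ = b ∘ e` is cubic with `perm(·)ᵢ` a first derivative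
on a block, and the transported dual `a₀ = a ∘ L⁻ᵀ ⊕ (L⁻ᵀ·)·c` is cubic of the dual shape `x''·perm⁻¹(x') ⊕ …`
(affine covariance of `Φ`, dual bent function of the Maiorana–McFarland class).
[cite: Carlet2020, Prop. 77] [cite: AaronsonAmbainis2018, §1.1.1] -/
theorem perm_quadratic (a b : (Fin (m + m) → Bool) → Bool) (ha : IsDegLeFun 3 a) (hb : IsDegLeFun 3 b)
    (hΦ : forrelation a b = 1 ∨ forrelation a b = -1)
    (e : (Fin (m + m) → Bool) ≃ (Fin (m + m) → Bool)) (M : Matrix (Fin (m + m)) (Fin (m + m)) (ZMod 2))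
    (c : Fin (m + m) → ZMod 2)
    (hM : ∀ y i, (if e y i then (1 : ZMod 2) else 0) = (M.mulVec (fun j => if y j then (1 : ZMod 2) else 0) + c) i)
    (perm : (Fin m → Bool) ≃ (Fin m → Bool)) (h : (Fin m → Bool) → Bool)
    (hbt : ∀ y' y'' : Fin m → Bool, (if b (e (Fin.append y' y'')) then (1 : ZMod 2) else 0) =
      (∑ i, (if y' i then (1 : ZMod 2) else 0) * (if perm y'' i then (1 : ZMod 2) else 0)) +
        (if h y'' then (1 : ZMod 2) else 0)) :
    (∀ i, IsDegLeFun 2 fun y => perm y i) ∧ (∀ i, IsDegLeFun 2 fun x => perm.symm x i) := by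
  -- adapted from `coreReduction_zero`, Steps 1–2
  -- ### the affine bijection `e y = L y ⊕ cb`, its inverse, adjoint and inverse adjoint
  obtain ⟨cb, hcbdef⟩ : ∃ cb : Fin (m + m) → Bool, cb = fun i => decide (c i = 1) := ⟨_, rfl⟩
  obtain ⟨L, hLdef⟩ : ∃ L : (Fin (m + m) → Bool) → (Fin (m + m) → Bool), ∀ y, L y = bxor (e y) cb := ⟨_, fun _ => rfl⟩
  have hcc : ∀ x : Fin (m + m) → Bool, bxor (bxor x cb) cb = x := fun x => ur_bxor_cancel_right x cb
  have hL : ∀ x y, L (bxor x y) = bxor (L x) (L y) := by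
    intro x y
    rw [hLdef, hLdef, hLdef, hcbdef]
    exact additive_linear_part e M c hM x y
  have he : ∀ y, e y = bxor (L y) cb := fun y => by rw [hLdef, hcc]
  obtain ⟨Li, hLidef⟩ : ∃ Li : (Fin (m + m) → Bool) → (Fin (m + m) → Bool), ∀ x, Li x = e.symm (bxor x cb) :=
    ⟨_, fun _ => rfl⟩
  have hLLi : ∀ x, L (Li x) = x := fun x => by rw [hLdef, hLidef, Equiv.apply_symm_apply, hcc]
  have hLiL : ∀ y, Li (L y) = y := fun y => by rw [hLidef, hLdef, hcc, Equiv.symm_apply_apply]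
  have hLi : ∀ x y, Li (bxor x y) = bxor (Li x) (Li y) := inverse_additive hL hLLi hLiL
  obtain ⟨Lt, hadj⟩ := exists_adjoint L hL
  obtain ⟨Lti, hadji⟩ := exists_adjoint Li hLi
  have hLti : ∀ x y, Lti (bxor x y) = bxor (Lti x) (Lti y) := adjoint_additive hadji
  have h1 : ∀ y, Lt (Lti y) = y := fun y => eq_of_bdot_eq fun x => by rw [← hadj, ← hadji, hLiL]
  have h2 : ∀ y, Lti (Lt y) = y := fun y => eq_of_bdot_eq fun x => by rw [← hadji, ← hadj, hLLi]
  -- ### the transported pair `b₀ = b ∘ e`, `a₀ = a ∘ L⁻ᵀ ⊕ (L⁻ᵀ ·)·cb`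
  obtain ⟨b₀, hb₀⟩ : ∃ b₀ : (Fin (m + m) → Bool) → Bool, ∀ y, b₀ y = b (e y) := ⟨_, fun _ => rfl⟩
  obtain ⟨a₀, ha₀⟩ : ∃ a₀ : (Fin (m + m) → Bool) → Bool,
      ∀ x, a₀ x = (a (Lti x) ^^ (univ.filter fun i => Lti x i && cb i).card.bodd) := ⟨_, fun _ => rfl⟩
  have ha₀' : ∀ x, a₀ x = (a (bxor (Lti x) zeroVec) ^^ (univ.filter fun i => Lti x i && cb i).card.bodd) :=
    fun x => by rw [ha₀, bxor_zeroVec]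
  have hlam : ∀ x y, (univ.filter fun i => Lti (bxor x y) i && cb i).card.bodd =
      ((univ.filter fun i => Lti x i && cb i).card.bodd ^^ (univ.filter fun i => Lti y i && cb i).card.bodd) :=
    fun x y => by rw [hLti, bdot_bxor_left]
  have hb₀3 : IsDegLeFun 3 b₀ := by
    have e1 : b₀ = fun y => b (bxor (L y) cb) := funext fun y => by rw [hb₀, he]
    rw [e1]
    exact isDegLeFun_comp_affine hb hL cb
  have ha₀3 : IsDegLeFun 3 a₀ := by
    rw [show a₀ = fun x => (a (bxor (Lti x) zeroVec) ^^ (univ.filter fun i => Lti x i && cb i).card.bodd) from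
      funext ha₀']
    exact (knf_isDegLeFun_xor' (isDegLeFun_comp_affine ha hLti zeroVec) (isDegLeFun_one_of_additive hlam)).mono
      (by norm_num)
  have hb₀t : ∀ y' y'' : Fin m → Bool, b₀ (Fin.append y' y'') =
      (((Finset.univ.filter fun i => y' i && (perm y'') i).card.bodd) ^^ h y'') := fun y' y'' => by
    rw [hb₀]
    exact template_bool (g := fun y => b (e y)) hbt y' y''
  have hΦ₀ : forrelation a₀ b₀ = 1 ∨ forrelation a₀ b₀ = -1 := by
    rw [forrelation_transport a b a₀ b₀ e L Lt Lti cb he hadj h1 h2 hb₀ ha₀]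
    exact hΦ
  have ha₀t := stub_dualShape m a₀ b₀ perm h hb₀t hΦ₀
  exact ⟨isDegLeFun_two_perm hb₀3 hb₀t, isDegLeFun_two_symm ha₀3 ha₀t⟩

/-! ### Cube-type orbit data are cube-orbit data -/

set_option maxHeartbeats 4000000 in
/-- **A cube-type orbit datum is a cube-orbit datum (with a linear term) of the same function.** If
`[b (e (y' ‖ y''))] = ∑ᵢ [y'ᵢ][perm(y'')ᵢ] + [h y'']` with `e` affine and `E₁ ∘ perm = cube ∘ E₂` blockwise for affine
bijections `E₁, E₂ : 𝔽₂^(3k) ≃ (𝔽₂³)^k`, then for the affine bijection `e' = e ∘ (N⁻ᵀ ‖ Λ₂⁻¹)` (`Λᵢ = flatten ∘ Eᵢ`,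
`N` the linear part of `Λ₁⁻¹`) one has `[b (e' (y' ‖ y''))] = ∑ᵢ [y'ᵢ][cube^k(y'')ᵢ] + [h (Λ₂⁻¹ y'')] + ∑ᵢ [y'ᵢ][ℓᵢ]`,
`ℓ = N⁻¹(Λ₁⁻¹ 0)`: indeed `(N⁻ᵀ p)·perm(Λ₂⁻¹ w) = (N⁻ᵀ p)·(N cube^k(w) ⊕ Λ₁⁻¹ 0) = p·cube^k(w) ⊕ p·N⁻¹(Λ₁⁻¹ 0)`.
[cite: Carlet2020, Prop. 54] -/
theorem cubeOrbitDatum {k : ℕ} (b : (Fin (k * 3 + k * 3) → Bool) → Bool)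
    (e : (Fin (k * 3 + k * 3) → Bool) ≃ (Fin (k * 3 + k * 3) → Bool))
    (M : Matrix (Fin (k * 3 + k * 3)) (Fin (k * 3 + k * 3)) (ZMod 2)) (c : Fin (k * 3 + k * 3) → ZMod 2)
    (hM : ∀ y i, (if e y i then (1 : ZMod 2) else 0) = (M.mulVec (fun j => if y j then (1 : ZMod 2) else 0) + c) i)
    (perm : (Fin (k * 3) → Bool) ≃ (Fin (k * 3) → Bool)) (h : (Fin (k * 3) → Bool) → Bool)
    (hbt : ∀ y' y'' : Fin (k * 3) → Bool, (if b (e (Fin.append y' y'')) then (1 : ZMod 2) else 0) =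
      (∑ i, (if y' i then (1 : ZMod 2) else 0) * (if perm y'' i then (1 : ZMod 2) else 0)) +
        (if h y'' then (1 : ZMod 2) else 0))
    (E₁ E₂ : (Fin (k * 3) → Bool) ≃ (Fin k → Fin 3 → Bool))
    (hE₁ : ∀ x y i j, E₁ (bxor x y) i j = (E₁ x i j ^^ E₁ y i j ^^ E₁ zeroVec i j))
    (hE₂ : ∀ x y i j, E₂ (bxor x y) i j = (E₂ x i j ^^ E₂ y i j ^^ E₂ zeroVec i j))
    (hcube : ∀ y i, E₁ (perm y) i = (fun x : Fin 3 → Bool => (![x 0 ^^ x 1 ^^ x 2 ^^ (x 1 && x 2), (x 0 && x 1) ^^ (x 0 && x 2) ^^ x 1, (x 0 && x 1) ^^ x 2] : Fin 3 → Bool)) (E₂ y i)) :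
    ∃ e' : (Fin (k * 3 + k * 3) → Bool) ≃ (Fin (k * 3 + k * 3) → Bool),
      (∃ M' : Matrix (Fin (k * 3 + k * 3)) (Fin (k * 3 + k * 3)) (ZMod 2), ∃ c' : Fin (k * 3 + k * 3) → ZMod 2,
        ∀ y i, (if e' y i then (1 : ZMod 2) else 0) = (M'.mulVec (fun j => if y j then (1 : ZMod 2) else 0) + c') i) ∧
      ∃ h' : (Fin (k * 3) → Bool) → Bool, ∃ ℓ : Fin (k * 3) → Bool, ∀ y' y'' : Fin (k * 3) → Bool,
        (if b (e' (Fin.append y' y'')) then (1 : ZMod 2) else 0) =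
          (∑ i, (if y' i then (1 : ZMod 2) else 0) * (if (fun x : Fin 3 → Bool => (![x 0 ^^ x 1 ^^ x 2 ^^ (x 1 && x 2), (x 0 && x 1) ^^ (x 0 && x 2) ^^ x 1, (x 0 && x 1) ^^ x 2] : Fin 3 → Bool)) (fun s => y'' (finProdFinEquiv ((finProdFinEquiv.symm i).1, s))) (finProdFinEquiv.symm i).2 then (1 : ZMod 2) else 0)) +
            (if h' y'' then (1 : ZMod 2) else 0) + (∑ i, (if y' i then (1 : ZMod 2) else 0) * (if ℓ i then (1 : ZMod 2) else 0)) := by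
  -- adapted from `coreReduction_zero`, Steps 1 and 5–8
  -- ### Step 1: `e` is affine, and the Boolean template identity
  obtain ⟨cb, hcbdef⟩ : ∃ cb : Fin (k * 3 + k * 3) → Bool, cb = fun i => decide (c i = 1) := ⟨_, rfl⟩
  obtain ⟨L, hLdef⟩ : ∃ L : (Fin (k * 3 + k * 3) → Bool) → (Fin (k * 3 + k * 3) → Bool), ∀ y, L y = bxor (e y) cb :=
    ⟨_, fun _ => rfl⟩
  have hcc : ∀ x : Fin (k * 3 + k * 3) → Bool, bxor (bxor x cb) cb = x := fun x => ur_bxor_cancel_right x cb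
  have hL : ∀ x y, L (bxor x y) = bxor (L x) (L y) := by
    intro x y
    rw [hLdef, hLdef, hLdef, hcbdef]
    exact additive_linear_part e M c hM x y
  have he : ∀ y, e y = bxor (L y) cb := fun y => by rw [hLdef, hcc]
  have hea : ∀ x y, e (bxor x y) = bxor (bxor (e x) (e y)) (e zeroVec) := by
    intro x y
    rw [he, he, he, he, hL, map_zeroVec hL, zeroVec_bxor]
    funext i
    show ((L x i ^^ L y i) ^^ cb i) = (((L x i ^^ cb i) ^^ (L y i ^^ cb i)) ^^ cb i)
    cases L x i <;> cases L y i <;> cases cb i <;> rfl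
  have hb₀t : ∀ y' y'' : Fin (k * 3) → Bool, b (e (Fin.append y' y'')) =
      (((Finset.univ.filter fun i => y' i && (perm y'') i).card.bodd) ^^ h y'') :=
    template_bool (g := fun y => b (e y)) hbt
  -- ### Step 5: block coordinates flattened; the affine bijections `Λ₁ = fl ∘ E₁`, `Λ₂ = fl ∘ E₂`
  let fl : (Fin k → Fin 3 → Bool) ≃ (Fin (k * 3) → Bool) :=
    (Equiv.curry (Fin k) (Fin 3) Bool).symm.trans (Equiv.arrowCongr finProdFinEquiv (Equiv.refl Bool))
  let Λ₁ : (Fin (k * 3) → Bool) ≃ (Fin (k * 3) → Bool) := E₁.trans fl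
  let Λ₂ : (Fin (k * 3) → Bool) ≃ (Fin (k * 3) → Bool) := E₂.trans fl
  have hΛ₁a : ∀ x y, Λ₁ (bxor x y) = bxor (bxor (Λ₁ x) (Λ₁ y)) (Λ₁ zeroVec) := fun x y => by
    funext i; exact hE₁ x y _ _
  have hΛ₂a : ∀ x y, Λ₂ (bxor x y) = bxor (bxor (Λ₂ x) (Λ₂ y)) (Λ₂ zeroVec) := fun x y => by
    funext i; exact hE₂ x y _ _
  -- the cube relation in flattened coordinates
  obtain ⟨CV, hCV⟩ : ∃ CV : (Fin (k * 3) → Bool) → (Fin (k * 3) → Bool), ∀ y'' i, CV y'' i =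
      (fun x : Fin 3 → Bool => (![x 0 ^^ x 1 ^^ x 2 ^^ (x 1 && x 2), (x 0 && x 1) ^^ (x 0 && x 2) ^^ x 1, (x 0 && x 1) ^^ x 2] : Fin 3 → Bool)) (fun s => y'' (finProdFinEquiv ((finProdFinEquiv.symm i).1, s))) (finProdFinEquiv.symm i).2 :=
    ⟨_, fun _ _ => rfl⟩
  have hcube' : ∀ y, Λ₁ (perm y) = CV (Λ₂ y) := by
    intro y
    funext i
    have e2 : (fun s => Λ₂ y (finProdFinEquiv ((finProdFinEquiv.symm i).1, s))) = E₂ y (finProdFinEquiv.symm i).1 := by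
      funext s
      show E₂ y (finProdFinEquiv.symm (finProdFinEquiv ((finProdFinEquiv.symm i).1, s))).1
          (finProdFinEquiv.symm (finProdFinEquiv ((finProdFinEquiv.symm i).1, s))).2 = _
      rw [Equiv.symm_apply_apply]
    rw [hCV, e2]
    exact congrFun (hcube y (finProdFinEquiv.symm i).1) (finProdFinEquiv.symm i).2
  -- ### Step 6: the linear part `N` of `Λ₁⁻¹`, its inverse `Ni`, adjoint `Nt` and inverse adjoint `Nti`
  have hΛ₁s := affine_symm Λ₁ hΛ₁a
  have hΛ₂s := affine_symm Λ₂ hΛ₂a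
  obtain ⟨c₁, hc₁⟩ : ∃ c₁ : Fin (k * 3) → Bool, c₁ = Λ₁.symm zeroVec := ⟨_, rfl⟩
  obtain ⟨N, hNdef⟩ : ∃ N : (Fin (k * 3) → Bool) → (Fin (k * 3) → Bool), ∀ z, N z = bxor (Λ₁.symm z) c₁ :=
    ⟨_, fun _ => rfl⟩
  have hN : ∀ x y, N (bxor x y) = bxor (N x) (N y) := fun x y => by
    rw [hNdef, hNdef, hNdef, hc₁]; exact linPart_additive hΛ₁s x y
  have hNsymm : ∀ z, Λ₁.symm z = bxor (N z) c₁ := fun z => by rw [hNdef, ur_bxor_cancel_right]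
  obtain ⟨Ni, hNidef⟩ : ∃ Ni : (Fin (k * 3) → Bool) → (Fin (k * 3) → Bool), ∀ w, Ni w = Λ₁ (bxor w c₁) :=
    ⟨_, fun _ => rfl⟩
  have hNNi : ∀ w, N (Ni w) = w := fun w => by rw [hNdef, hNidef, Equiv.symm_apply_apply, ur_bxor_cancel_right]
  have hNiN : ∀ z, Ni (N z) = z := fun z => by rw [hNidef, hNdef, ur_bxor_cancel_right, Equiv.apply_symm_apply]
  have hNi : ∀ x y, Ni (bxor x y) = bxor (Ni x) (Ni y) := inverse_additive hN hNNi hNiN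
  obtain ⟨Nt, hadjN⟩ := exists_adjoint N hN
  obtain ⟨Nti, hadjNi⟩ := exists_adjoint Ni hNi
  have hNti : ∀ x y, Nti (bxor x y) = bxor (Nti x) (Nti y) := adjoint_additive hadjNi
  have hN1 : ∀ y, Nt (Nti y) = y := fun y => eq_of_bdot_eq fun x => by rw [← hadjN, ← hadjNi, hNiN]
  have hN2 : ∀ y, Nti (Nt y) = y := fun y => eq_of_bdot_eq fun x => by rw [← hadjNi, ← hadjN, hNNi]
  -- ### Step 7: the affine bijection `Θ = e ∘ (N⁻ᵀ ‖ Λ₂⁻¹)` and its inverse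
  obtain ⟨Ψ, hΨ⟩ : ∃ Ψ : (Fin (k * 3 + k * 3) → Bool) → (Fin (k * 3 + k * 3) → Bool), ∀ y,
      Ψ y = Fin.append (Nt (fun i => y (Fin.castAdd (k * 3) i))) (Λ₂ (fun j => y (Fin.natAdd (k * 3) j))) :=
    ⟨_, fun _ => rfl⟩
  obtain ⟨Ψi, hΨi⟩ : ∃ Ψi : (Fin (k * 3 + k * 3) → Bool) → (Fin (k * 3 + k * 3) → Bool), ∀ x,
      Ψi x = Fin.append (Nti (fun i => x (Fin.castAdd (k * 3) i))) (Λ₂.symm (fun j => x (Fin.natAdd (k * 3) j))) :=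
    ⟨_, fun _ => rfl⟩
  have hΨΨi : ∀ x, Ψ (Ψi x) = x := fun x => by
    rw [hΨ, hΨi, castAdd_comp_append, natAdd_comp_append, hN1, Equiv.apply_symm_apply, Fin.append_castAdd_natAdd]
  have hΨiΨ : ∀ y, Ψi (Ψ y) = y := fun y => by
    rw [hΨi, hΨ, castAdd_comp_append, natAdd_comp_append, hN2, Equiv.symm_apply_apply, Fin.append_castAdd_natAdd]
  have hΨia : ∀ x y, Ψi (bxor x y) = bxor (bxor (Ψi x) (Ψi y)) (Ψi zeroVec) := by
    intro x y
    rw [hΨi, hΨi, hΨi, hΨi, bxor_append, bxor_append]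
    congr 1
    · rw [show (fun i => bxor x y (Fin.castAdd (k * 3) i)) = bxor (fun i => x (Fin.castAdd (k * 3) i))
        (fun i => y (Fin.castAdd (k * 3) i)) from rfl, hNti,
        show (fun i => (zeroVec : Fin (k * 3 + k * 3) → Bool) (Fin.castAdd (k * 3) i)) = zeroVec from rfl,
        map_zeroVec hNti, bxor_zeroVec]
    · rw [show (fun j => bxor x y (Fin.natAdd (k * 3) j)) = bxor (fun j => x (Fin.natAdd (k * 3) j))
        (fun j => y (Fin.natAdd (k * 3) j)) from rfl, hΛ₂s]
      rfl
  obtain ⟨Θ, hΘ⟩ : ∃ Θ : (Fin (k * 3 + k * 3) → Bool) → (Fin (k * 3 + k * 3) → Bool), ∀ x, Θ x = e (Ψi x) :=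
    ⟨_, fun _ => rfl⟩
  obtain ⟨Θi, hΘi⟩ : ∃ Θi : (Fin (k * 3 + k * 3) → Bool) → (Fin (k * 3 + k * 3) → Bool), ∀ y, Θi y = Ψ (e.symm y) :=
    ⟨_, fun _ => rfl⟩
  have hΘΘi : ∀ y, Θ (Θi y) = y := fun y => by rw [hΘ, hΘi, hΨiΨ, Equiv.apply_symm_apply]
  have hΘiΘ : ∀ x, Θi (Θ x) = x := fun x => by rw [hΘi, hΘ, Equiv.symm_apply_apply, hΨΨi]
  have hΘa : ∀ x y, Θ (bxor x y) = bxor (bxor (Θ x) (Θ y)) (Θ zeroVec) := by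
    intro x y
    rw [hΘ, hΘ, hΘ, hΘ, hΨia, affine_bxor₃ hea]
  -- ### Step 8: the template of `b` in the coordinates `Θ`
  have hpermq : ∀ q, perm q = bxor (N (CV (Λ₂ q))) c₁ := fun q => by
    rw [← hNsymm, ← hcube', Equiv.symm_apply_apply]
  have hadjchain : ∀ p w : Fin (k * 3) → Bool, (univ.filter fun i => Nti p i && N w i).card.bodd =
      (univ.filter fun i => p i && w i).card.bodd := fun p w => by
    rw [bdot_comm, hadjN, hN1, bdot_comm]
  have hNic : ∀ p : Fin (k * 3) → Bool, (univ.filter fun i => Nti p i && c₁ i).card.bodd =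
      (univ.filter fun i => p i && Ni c₁ i).card.bodd := fun p => by
    rw [bdot_comm (Nti p) c₁, ← hadjNi, bdot_comm]
  obtain ⟨hc, hhc⟩ : ∃ hc : (Fin (k * 3) → Bool) → Bool, ∀ w, hc w = h (Λ₂.symm w) := ⟨_, fun _ => rfl⟩
  have hΘt : ∀ y' y'' : Fin (k * 3) → Bool, b (Θ (Fin.append y' y'')) =
      ((((univ.filter fun i => y' i && CV y'' i).card.bodd) ^^ hc y'') ^^
        (univ.filter fun i => y' i && Ni c₁ i).card.bodd) := by
    intro y' y''
    rw [hΘ, hΨi, castAdd_comp_append, natAdd_comp_append, hb₀t, hpermq, Equiv.apply_symm_apply, bdot_bxor_right,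
      hadjchain, hNic, hhc]
    generalize (univ.filter fun i => y' i && CV y'' i).card.bodd = A
    generalize (univ.filter fun i => y' i && Ni c₁ i).card.bodd = B
    generalize h (Λ₂.symm y'') = X
    revert A B X; decide
  -- ### the cube-orbit datum `e' = Θ`, `h' = h ∘ Λ₂⁻¹`, `ℓ = N⁻¹ c₁`, read in `ZMod 2`
  refine ⟨⟨Θ, Θi, hΘiΘ, hΘΘi⟩, affine_toMatrix hΘa, hc, Ni c₁, fun y' y'' => ?_⟩
  change toZ (b (Θ (Fin.append y' y''))) =
    (∑ i, toZ (y' i) * toZ _) + toZ (hc y'') + ∑ i, toZ (y' i) * toZ (Ni c₁ i)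
  rw [hΘt, toZ_xor, toZ_xor, toZ_bdot, toZ_bdot]
  congr 1
  · congr 1
    refine sum_congr rfl fun i _ => ?_
    rw [toZ_and, hCV]
  · exact sum_congr rfl fun i _ => toZ_and _ _

end Covariance

end Summit.QuantumAdvantage.QuantumAdvantage.Theorems.SignedExactCubicForrelationNotPrBPP

end
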